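import Literature.MathematicalPhysics.QuantumFieldTheory.Balaban1983to89.B9Eq3126GreenLettersVariational
import Literature.MathematicalPhysics.QuantumFieldTheory.Balaban1983to89.B9Eq3126BondTentProfile
import Literature.MathematicalPhysics.QuantumFieldTheory.Balaban1983to89.B9Eq3126BondTentLift
import Literature.MathematicalPhysics.QuantumFieldTheory.Balaban1983to89.B9Eq3126BondLiftEnergy
import Literature.MathematicalPhysics.QuantumFieldTheory.Balaban1983to89.B9Eq368ProjectionRemainder

/-!
# `Balaban1983to89.B9Eq3126KFloorFlat` — T. Bałaban, *Propagators for lattice gauge theories in a background field*, Commun. Math. Phys. **99** (1985)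
# 389–434 [Balaban1985BackgroundPropagators] (3.126) p. 420 *«HB = GQ*(QGQ*)⁻¹B»*, Thm 3.11 p. 416, (3.26) p. 395, with [Balaban1985Variational] (45)–(46)
# p. 285: **AT THE FLAT BACKGROUND THE LETTERS `(Q(1)G₁(1)Q(1)†)⁻¹` AND `H₁(1)` OF THE pub-balaban NE9 CHAIN ARE BOUNDED BY THE COERCIVITY CONSTANT OF
# `Δ_a(1)` AND THE BOND TENT ALONE — `‖(QG₁Q†)⁻¹‖ ≤ M_u∕(A−B)²`, `‖H₁‖ ≤ √(M_u∕(γ(A−B)²))` with the tent's explicit pairing margin `A − B ∝ L^{2d+1}` and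
# energy `M_u ∝ |η|⁻²L^{4d}·(c₀L^d∕c₁) + aL^{4d+2}` — NO OPERATOR BOUND OF `Δ_a`, NO VOLUME; on the diagonal `ηL = 1`, `c₀L^d = c₁` a function of `(d, a, γ)`**

statement-level skeleton of published theorems with citation tags; proofs where landed; nothing here is a claim about the Yang–Mills mass gap

CITATION HEADER (lean-in-tree rule).  Audit cell `pub-balaban`, sub-cell `t4`, BINDER row NE9; filed by NE9 formalisation-swarm LEAF PROVER 02
(`b2b-balaban-t4-ne9-formalise-leaf-02`, gen 65).  Sources READ in the held text layers: [Balaban1985BackgroundPropagators]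
(`paper:balaban1985-cmp99-background-propagators`, journal page = PDF page + 388) pp. 391–395 (3.4), (3.8), (3.10)–(3.11), (3.15), (3.21), (3.26), p. 416
Thm 3.11, p. 420 (3.126); [Balaban1985Variational] (`paper:balaban1985-cmp102-variational-background`, journal page = PDF page + 276) p. 285 (45)–(46);
[Balaban1985Averaging] (`paper:balaban1985-cmp98-averaging`, journal page = PDF page + 16) p. 36 (125).

THE PRINT (verbatim).  [B9] p. 416, Thm 3.11: *«Under the assumptions of the Theorems 3.1–3.10 (i.e. for M sufficiently large and α₀ sufficiently small) the
operators Δ′_a, G′, (Q′G′²Q′*)⁻¹, Δ_a, G are positive definite.»*; p. 420, (3.126): *«HB = GQ*(QGQ*)⁻¹B»*; [B11] p. 285: *«H … giving a minimum of the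
quadratic form ½⟨A, ΔA⟩ under the restrictions L^jηQ_jA = B … and the Theorem 3.12 from [5] implies |HB| ≤ B₀(L^jη)^{−1}|B| … (46)»* — `B₀` uniform in
the lattice.  [B7] (125) p. 36: *«(Q₀A)_c = Σ_{x∈B(c₋)} L^{−(d+1)} A([x, x′])»*.

WHY THIS FILE (cell context).  The chain's `C_H`, `C_K` for `H₁ = G₁Q†(QG₁Q†)⁻¹` and `(QG₁Q†)⁻¹` (`B9Eq3126GreenLetters`, `B9Eq3126H1Bound` ∕ `…Tower` §3)
carry the OPERATOR bound `M ∝ |η|⁻²` of `Δ_a`, squared — `|η|⁻⁴ = L^{4(n+1)}` on print's diagonal, the `H`-analogue of the `C_R` obstruction the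
OWNER's TOWER-R-PROGRAMME (g85) removed.  `B9Eq3126GreenLettersVariational` (this lineage) replaced `M` by the ENERGY of one test family; this file
INHABITS that family at the flat one-step averaging with the BOND TENT of `B9Eq3126BondTentLift` ∕ `B9Eq3126BondLiftEnergy` ∕ `B9Eq3126BondTentProfile`
(transverse profile `k(L−1−k)`, skewed depth profile `k²(L−1−k)`): §1 the energy of ANY test field at `Δ_a(1)` is at most `‖curl u‖² + ‖D*u‖² + a‖Q(1)u‖²`
(curvature `= 0`, `R` a contraction — forms only); §2 the tent's pairing margin `A − B` (two sweep numbers; `≥ L^{−(d+1)}(L³∕27)^{d−1}L⁵∕1215`), size and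
energy (`M_u`); §3 the floor of `K = Q(1)G₁(1)Q(1)†` and the size of `H₁(1)` with NO `‖Δ_a‖`.  The powers match: `(A−B)² ∝ L^{4d+2}` against
`M_u ∝ ‖η⁻¹‖²L^{4d}(c₀L^d∕c₁) + aL^{4d+2}`, so on the diagonal `ηL = 1`, `c₀L^d = c₁` the ratio is a function of `(d, a)` — level- and volume-free
(crude: `180d·1215²(729∕16)^{d−1} + 2a(405∕4)²(81∕4)^{d−1}`; no attempt at the optimal bump).  The `k`-level instance on the diagonal rides on the
OWNER's `B9Eq316TowerFlatIsOneStep.QkW_one_eq_oneStep` (flat tower = one step at block `L^{n+1}`) and INTENT-8∕-9's closed `γ`; the windowed `U` is a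
FORM perturbation of `hux`∕`huu` by `α` (not `α∕η`) — sequels.

WHAT IS PROVED (sorry-free; 0 `def`; [folklore] compositions of the three kit files and the variational letters; nothing of [B9]∕[B11] asserted).
* §1 **`re_inner_laplaceAofBackground_one_le`** — `re⟪u, Δ_a(1)u⟫ ≤ ‖η⁻¹curl u‖² + ‖η⁻¹D*u‖² + a‖Q(1)u‖²` for EVERY `u` and real `a`.
* §2 **`re_inner_QtorusW_one_tent_ge`** (`(A − B)‖ψ‖² ≤ re⟪Q(1)u_ψ, ψ⟫`), **`tent_margin_ge`** (`A − B ≥ L^{−(d+1)}(L³∕27)^{d−1}L⁵∕1215`, `3 ≤ L`),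
  `norm_sq_QtorusW_one_tent_le` (`‖Q(1)u_ψ‖² ≤ 2(A²+B²)‖ψ‖²`), `norm_tent_step_le` (per-step `6L²(L²∕4)^{d−1}`), **`re_inner_laplaceAofBackground_one_tent_le`**
  (`re⟪u_ψ, Δ_a(1)u_ψ⟫ ≤ M_u‖ψ‖²`, `M_u = ‖η⁻¹‖²(6L²(L²∕4)^{d−1})²·5d·(c₀L^d∕c₁) + 2a(A²+B²)`).
* §3 `laplaceAofBackground_one_isSymmetric`; **`norm_KinvLatticeK_H1LatticeK_one_le`** — for `3 ≤ L`, `a > 0`, a displayed coercivity constant `γ` of `Δ_a(1)` and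
  ANY `hpos`, `hQ`: `‖KinvLatticeK hpos hQ y‖ ≤ (M_u∕(A−B)²)‖y‖` and `‖H1LatticeK hpos hQ b‖ ≤ √(M_u∕(γ(A−B)²))‖b‖`.
MODEL ∕ HONEST SCOPE.  One averaging step, flat background, periodic lattice, `3 ≤ L`; crude explicit constants; the coercivity `γ` of `Δ_a(1)` DISPLAYED (flat: the
tree's `B5Eq172FlatCoercivity` ∕ the OWNER's diagonal chain); `𝔊 = G₁𝔓*` NOT treated; NOT print's `B₀` of (46) (a kernel∕decay statement, [B9] Thm 3.12), only its
`L²`-operator shadow at `U = 1`; NOT NE9, NOT the route (cell pub-balaban: NE9 NOT PRINTED ∕ NOT PROVED; «NE9 ⇐ the named binders»; row WALLED ON A MODEL (O-NE9-1;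
#5 UNRULED); spine PROVED 0∕9; rung (B)+1 on a finite T⁴ — NOT infinite volume, NOT mass gap, NOT BetaPertH, NOT Clay).  HONEST DEPENDENCY (cell line): continuum YM
on T⁴ ⇐ BetaPertH ∧ nine spine estimates (0/9 proved); BetaPertH ⇐ (D1) ∧ (D4) ∧ CAP+tail; G-an2-4 gates asym, D1 and NE2/3/4.  NEW file importing this lineage's
`B9Eq3126GreenLettersVariational`, `B9Eq3126BondTentProfile`, `B9Eq3126BondTentLift`, `B9Eq3126BondLiftEnergy` and `B9Eq368ProjectionRemainder` (ne9-leaf-04);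
nothing modified.  Net new unproved facts: 0.
-/

noncomputable section

open scoped InnerProductSpace ComplexConjugate BigOperators

namespace Literature.MathematicalPhysics.QuantumFieldTheory.Balaban1983to89.B9Eq3126KFloorFlat

open B4Sect5Torus (TSite)
open B9SectCLatticeCarrier (Bond shift)
open B9Eq311L2Pairing (WL2)
open B9Eq319QprimeTorus (fineP offset offset_lt blockCoord)
open B9Eq315QTorus (perCfg cornerSite QtorusW laplaceAofBackground laplaceAofBackground_eq)
open B7Prop1Explicit (U1 Wcx boxVec)
open B11Eq103H1Complex (SiteL2K BondL2K covDerivL2K covDivL2K laplaceALatticeK laplaceAK laplaceAK_apply H1LatticeK KinvLatticeK G1LatticeK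
  hadj_adjoint adjoint_injective_of_surjective adjoint_covDerivL2K)
open B9Eq310HessianOperator (adTransportW hessOp hessOp_one principalOpK_eq_comp covCurlL2K inner_covCoCurlL2K_covCurlL2K principalOpK_isSymmetric)
open B5Eq172HodgePositivity (adTransportW_one hRS_one)
open B9Eq326OperatorAssembly (RofU RofU_isSymmetric laplaceAofU laplaceAofU_eq)
open B9Eq368ProjectionRemainder (norm_projR_le)

/-! ## §1 The energy of a test field at the flat one-step operator: `re⟪u, Δ_a(1)u⟫ ≤ ‖curl u‖² + ‖D*u‖² + a‖Q(1)u‖²` -/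

section Energy

variable {d : ℕ} (L : ℕ) [NeZero L] (m : Fin d → ℕ) [∀ i, NeZero (fineP L m i)]
  {𝔸 : Type*} [NormedRing 𝔸] [NormedAlgebra ℂ 𝔸] [CompleteSpace 𝔸] [NormOneClass 𝔸] [StarRing 𝔸] [StarModule ℂ 𝔸] (hL : 1 ≤ L)
  {α' : ℝ} (hα1' : α' ≤ 1 / 64)
  (hU1' : ∀ (x : B7Prop1Explicit.Site d) (κ : Fin d), perCfg (fineP L m) (fun _ : Bond d (fineP L m) => (1 : 𝔸ˣ)) x κ ∈ U1 𝔸)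
  (hreg' : ∀ (y : TSite d m) (κ : Fin d) (r : Fin d → Fin L),
    ‖((Wcx L (perCfg (fineP L m) (fun _ : Bond d (fineP L m) => (1 : 𝔸ˣ))) (cornerSite L y) κ (boxVec L r) : 𝔸ˣ) : 𝔸) - 1‖ ≤ α')
  {W : Type*} [NormedAddCommGroup W] [InnerProductSpace ℂ W] [FiniteDimensional ℂ W] (φ : W ≃ₗ[ℂ] 𝔸)
  {c₀ c₁ : ℝ} [Fact (0 < c₀)] [Fact (0 < c₁)] (τ : 𝔸 →ₗ[ℂ] ℂ) (η : ℝ)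

/-- **THE ENERGY OF A TEST FIELD AT THE FLAT ONE-STEP OPERATOR (3.26)**: for every real `a` and every `u`,
`re⟪u, Δ_a(1)u⟫ ≤ ‖η⁻¹·curl u‖² + ‖η⁻¹·D*u‖² + a·‖Q(1)u‖²` — the Hessian at the flat background is `D*D` (the curvature part vanishes,
`hessOp_one`) with `⟪u, D*Du⟫ = ‖curl u‖²`; the gauge term `⟪u, DRD*u⟫ = ⟪D*u, RD*u⟫ ≤ ‖D*u‖²` (`D* = D†` at mutually adjoint transporters, `R` a
contraction); the penalty `⟪u, Q†aQu⟫ = a‖Qu‖²`.  Only FORMS of `u` — the currency of `B9Eq3126GreenLettersVariational`. [folklore]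
[cite: Balaban1985BackgroundPropagators, (3.26) p.395, (3.10) p.392, (3.21) p.394; Balaban1985Variational, (110) p.294] -/
theorem re_inner_laplaceAofBackground_one_le (a : ℝ) (u : BondL2K ℂ d (fineP L m) c₀ W) :
    RCLike.re ⟪u, laplaceAofBackground L m hL φ (fun _ : Bond d (fineP L m) => (1 : 𝔸ˣ)) hα1' hU1' hreg' τ η (c₀ := c₀) (c₁ := c₁) a u⟫_ℂ ≤
      ‖covCurlL2K ℂ c₀ ((η : ℂ))⁻¹ (adTransportW φ (fun _ : Bond d (fineP L m) => (1 : 𝔸ˣ))) u‖ ^ 2 +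
      ‖covDivL2K ℂ c₀ ((η : ℂ))⁻¹ (adTransportW φ (fun _ : Bond d (fineP L m) => (1 : 𝔸ˣ)⁻¹)) u‖ ^ 2 +
      a * ‖QtorusW L m hL φ (fun _ : Bond d (fineP L m) => (1 : 𝔸ˣ)) hα1' hU1' hreg' (c₀ := c₀) (c₁ := c₁) u‖ ^ 2 := by
  have hc : conj (((η : ℂ))⁻¹) = ((η : ℂ))⁻¹ := by rw [map_inv₀, Complex.conj_ofReal]
  rw [laplaceAofBackground_eq, laplaceAofU_eq, hessOp_one]
  unfold laplaceALatticeK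
  rw [laplaceAK_apply, inner_add_right, inner_add_right, map_add, map_add]
  -- the three terms
  have T1 : RCLike.re ⟪u, B9Eq310HessianOperator.principalOpK φ η (fun _ : Bond d (fineP L m) => (1 : 𝔸ˣ)) u⟫_ℂ =
      ‖covCurlL2K ℂ c₀ ((η : ℂ))⁻¹ (adTransportW φ (fun _ : Bond d (fineP L m) => (1 : 𝔸ˣ))) u‖ ^ 2 := by
    rw [principalOpK_eq_comp, LinearMap.comp_apply, inner_covCoCurlL2K_covCurlL2K _ hc _ _ (hRS_one φ), ← RCLike.ofReal_pow, RCLike.ofReal_re]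
  have T2 : RCLike.re ⟪u, covDerivL2K ℂ c₀ ((η : ℂ))⁻¹ (adTransportW φ (fun _ : Bond d (fineP L m) => (1 : 𝔸ˣ)))
      (RofU L m φ η (fun _ : Bond d (fineP L m) => (1 : 𝔸ˣ))
        (covDivL2K ℂ c₀ ((η : ℂ))⁻¹ (adTransportW φ (fun _ : Bond d (fineP L m) => (1 : 𝔸ˣ)⁻¹)) u))⟫_ℂ ≤
      ‖covDivL2K ℂ c₀ ((η : ℂ))⁻¹ (adTransportW φ (fun _ : Bond d (fineP L m) => (1 : 𝔸ˣ)⁻¹)) u‖ ^ 2 := by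
    rw [← LinearMap.adjoint_inner_left, adjoint_covDerivL2K _ hc _ _ (hRS_one φ)]
    refine (re_inner_le_norm _ _).trans ?_
    have hR : ‖RofU L m φ η (fun _ : Bond d (fineP L m) => (1 : 𝔸ˣ))
        (covDivL2K ℂ c₀ ((η : ℂ))⁻¹ (adTransportW φ (fun _ : Bond d (fineP L m) => (1 : 𝔸ˣ)⁻¹)) u)‖ ≤
        ‖covDivL2K ℂ c₀ ((η : ℂ))⁻¹ (adTransportW φ (fun _ : Bond d (fineP L m) => (1 : 𝔸ˣ)⁻¹)) u‖ := by
      unfold RofU B11Eq103H1Complex.RLatticeK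
      exact norm_projR_le _ _ _
    rw [sq]
    exact mul_le_mul_of_nonneg_left hR (norm_nonneg _)
  have T3 : RCLike.re ⟪u, LinearMap.adjoint (QtorusW L m hL φ (fun _ : Bond d (fineP L m) => (1 : 𝔸ˣ)) hα1' hU1' hreg' (c₀ := c₀) (c₁ := c₁))
      (((a : ℝ) : ℂ) • QtorusW L m hL φ (fun _ : Bond d (fineP L m) => (1 : 𝔸ˣ)) hα1' hU1' hreg' (c₀ := c₀) (c₁ := c₁) u)⟫_ℂ =
      a * ‖QtorusW L m hL φ (fun _ : Bond d (fineP L m) => (1 : 𝔸ˣ)) hα1' hU1' hreg' (c₀ := c₀) (c₁ := c₁) u‖ ^ 2 := by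
    rw [LinearMap.adjoint_inner_right, inner_smul_right, ← inner_self_eq_norm_sq (𝕜 := ℂ)]
    simp only [RCLike.re_to_complex, Complex.re_ofReal_mul]
  have h := add_le_add (add_le_add (le_of_eq T1) T2) (le_of_eq T3)
  exact h

end Energy

/-! ## §2 The bond tent test family at `Q(1)`: pairing margin, size and energy -/

section TestFamily

variable {d : ℕ} (L : ℕ) [NeZero L] (m : Fin d → ℕ) [∀ i, NeZero (fineP L m i)]
  {𝔸 : Type*} [NormedRing 𝔸] [NormedAlgebra ℂ 𝔸] [CompleteSpace 𝔸] [NormOneClass 𝔸] [StarRing 𝔸] [StarModule ℂ 𝔸] (hL : 1 ≤ L)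
  {α' : ℝ} (hα1' : α' ≤ 1 / 64)
  (hU1' : ∀ (x : B7Prop1Explicit.Site d) (κ : Fin d), perCfg (fineP L m) (fun _ : Bond d (fineP L m) => (1 : 𝔸ˣ)) x κ ∈ U1 𝔸)
  (hreg' : ∀ (y : TSite d m) (κ : Fin d) (r : Fin d → Fin L),
    ‖((Wcx L (perCfg (fineP L m) (fun _ : Bond d (fineP L m) => (1 : 𝔸ˣ))) (cornerSite L y) κ (boxVec L r) : 𝔸ˣ) : 𝔸) - 1‖ ≤ α')
  {W : Type*} [NormedAddCommGroup W] [InnerProductSpace ℂ W] [FiniteDimensional ℂ W] (φ : W ≃ₗ[ℂ] 𝔸)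
  {c₀ c₁ : ℝ} [Fact (0 < c₀)] [Fact (0 < c₁)] (τ : 𝔸 →ₗ[ℂ] ℂ) (η : ℝ)

omit [StarRing 𝔸] [StarModule ℂ 𝔸] [FiniteDimensional ℂ W] [Fact (0 < c₀)] in
/-- **THE PAIRING MARGIN OF THE BOND TENT**: with the transverse profile `f₀(k) = k(L−1−k)` and the skewed depth profile `f₁(k) = k²(L−1−k)`, the lift
`u_ψ(x,κ) = f₁(off_κ x)Π_{ν≠κ}f₀(off_ν x)·ψ(blk x, κ)` has `(A − B)·‖ψ‖² ≤ re⟪Q(1)u_ψ, ψ⟫` with the two sweep numbers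
`A = L^{−(d+1)}(Σf₀)^{d−1}Σ_kΣ_{i<L−k}f₁(k+i)`, `B = L^{−(d+1)}(Σf₀)^{d−1}Σ_kΣ_{t<k}f₁(t) ≥ 0`. [folklore]
[cite: Balaban1985Averaging, (125) p.36; Balaban1985BackgroundPropagators, (3.15) p.393, Thm 3.11 p.416] -/
theorem re_inner_QtorusW_one_tent_ge (ψ : BondL2K ℂ d m c₁ W) :
    (((L : ℝ) ^ (d + 1))⁻¹ * ((∑ k ∈ Finset.range L, (k : ℝ) * ((L : ℝ) - 1 - k)) ^ (d - 1) *
          ∑ k ∈ Finset.range L, ∑ i ∈ Finset.range (L - k), ((k + i : ℕ) : ℝ) ^ 2 * ((L : ℝ) - 1 - ((k + i : ℕ) : ℝ))) -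
        ((L : ℝ) ^ (d + 1))⁻¹ * ((∑ k ∈ Finset.range L, (k : ℝ) * ((L : ℝ) - 1 - k)) ^ (d - 1) *
          ∑ k ∈ Finset.range L, ∑ t ∈ Finset.range k, (t : ℝ) ^ 2 * ((L : ℝ) - 1 - t))) * ‖ψ‖ ^ 2 ≤
      RCLike.re ⟪QtorusW L m hL φ (fun _ : Bond d (fineP L m) => (1 : 𝔸ˣ)) hα1' hU1' hreg' (c₀ := c₀) (c₁ := c₁)
        ((WL2.equiv ℂ (fun _ : Bond d (fineP L m) => c₀) W).symm
          (fun b => (((((offset L m b.1 b.2 : ℕ) : ℝ) ^ 2 * ((L : ℝ) - 1 - (offset L m b.1 b.2 : ℕ))) *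
              ∏ ν ∈ Finset.univ.erase b.2, (((offset L m b.1 ν : ℕ) : ℝ) * ((L : ℝ) - 1 - (offset L m b.1 ν : ℕ))) : ℝ) : ℂ) •
            WL2.equiv ℂ (fun _ : Bond d m => c₁) W ψ (blockCoord L m b.1, b.2))), ψ⟫_ℂ := by
  have hv := B9Eq3126BondTentLift.QtorusW_one_twoProfileLift_apply L m hL hα1' hU1' hreg' φ c₀ c₁
    (fun k : ℕ => (k : ℝ) * ((L : ℝ) - 1 - k)) (fun k : ℕ => (k : ℝ) ^ 2 * ((L : ℝ) - 1 - k)) ψ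
  have h := B9Eq3126BondTentLift.re_inner_ge_of_twoBlock m c₁ _ ψ hv
  -- `B ≥ 0`, so `|B| = B`
  have hB : 0 ≤ ((L : ℝ) ^ (d + 1))⁻¹ * ((∑ k ∈ Finset.range L, (k : ℝ) * ((L : ℝ) - 1 - k)) ^ (d - 1) *
      ∑ k ∈ Finset.range L, ∑ t ∈ Finset.range k, (t : ℝ) ^ 2 * ((L : ℝ) - 1 - t)) := by
    have h0 : 0 ≤ ∑ k ∈ Finset.range L, (k : ℝ) * ((L : ℝ) - 1 - k) :=
      Finset.sum_nonneg fun k hk => B9Eq319BlockTentLift.profile_nonneg (Finset.mem_range.1 hk)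
    have h1 : 0 ≤ ∑ k ∈ Finset.range L, ∑ t ∈ Finset.range k, (t : ℝ) ^ 2 * ((L : ℝ) - 1 - t) :=
      Finset.sum_nonneg fun k hk => Finset.sum_nonneg fun t ht =>
        B9Eq3126BondTentProfile.qprof_nonneg (lt_trans (Finset.mem_range.1 ht) (Finset.mem_range.1 hk))
    positivity
  rw [abs_of_nonneg hB] at h
  simpa only [Nat.cast_add] using h

omit [NeZero L] in
/-- **THE MARGIN IS OF ORDER `L^{2d+1}`**: for `3 ≤ L`, `A − B ≥ L^{−(d+1)}·(L³∕27)^{d−1}·(L⁵∕1215)` — the sweep counts give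
`A − B = L^{−(d+1)}P^{d−1}Σ(2k+2−L)q(k)` with `P = Σk(L−1−k) ≥ L³∕27` and `Σ(2k+2−L)k²(L−1−k) ≥ L⁵∕1215` (`B9Eq3126BondTentProfile`). [folklore]
[cite: Balaban1985Averaging, (125) p.36; Balaban1985BackgroundPropagators, Thm 3.11 p.416] -/
theorem tent_margin_ge (hL3 : 3 ≤ L) :
    ((L : ℝ) ^ (d + 1))⁻¹ * (((L : ℝ) ^ 3 / 27) ^ (d - 1) * ((L : ℝ) ^ 5 / 1215)) ≤
      ((L : ℝ) ^ (d + 1))⁻¹ * ((∑ k ∈ Finset.range L, (k : ℝ) * ((L : ℝ) - 1 - k)) ^ (d - 1) *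
          ∑ k ∈ Finset.range L, ∑ i ∈ Finset.range (L - k), ((k + i : ℕ) : ℝ) ^ 2 * ((L : ℝ) - 1 - ((k + i : ℕ) : ℝ))) -
        ((L : ℝ) ^ (d + 1))⁻¹ * ((∑ k ∈ Finset.range L, (k : ℝ) * ((L : ℝ) - 1 - k)) ^ (d - 1) *
          ∑ k ∈ Finset.range L, ∑ t ∈ Finset.range k, (t : ℝ) ^ 2 * ((L : ℝ) - 1 - t)) := by
  have hA := B9Eq3126BondTentProfile.sum_sum_range_sub_eq (fun n : ℕ => (n : ℝ) ^ 2 * ((L : ℝ) - 1 - n)) L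
  have hB := B9Eq3126BondTentProfile.sum_sum_range_lt_eq (fun n : ℕ => (n : ℝ) ^ 2 * ((L : ℝ) - 1 - n)) L
  simp only [Nat.cast_add] at hA ⊢
  rw [← mul_sub, ← mul_sub, hA, hB, B9Eq3126BondTentProfile.sum_succ_mul_qprof_sub]
  have hP := B9Eq3126BondTentProfile.sum_profile_ge hL3
  have hS := B9Eq3126BondTentProfile.sum_skew_qprof_ge_pow hL3
  have hL0 : (0 : ℝ) < L := by exact_mod_cast (by omega : 0 < L)
  have hP0 : 0 ≤ (L : ℝ) ^ 3 / 27 := by positivity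
  have hPpow := pow_le_pow_left₀ hP0 hP (d - 1)
  have hS0 : 0 ≤ (L : ℝ) ^ 5 / 1215 := by positivity
  exact mul_le_mul_of_nonneg_left (mul_le_mul hPpow hS hS0 (le_trans (pow_nonneg hP0 _) hPpow)) (by positivity)


omit [StarRing 𝔸] [StarModule ℂ 𝔸] [FiniteDimensional ℂ W] [Fact (0 < c₀)] in
/-- **THE SIZE OF `Q(1)` ON THE BOND TENT**: `‖Q(1)u_ψ‖² ≤ 2(A² + B²)‖ψ‖²` with the same two sweep numbers. [folklore]
[cite: Balaban1985Averaging, (125) p.36; Balaban1985BackgroundPropagators, (3.15)–(3.16) p.393] -/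
theorem norm_sq_QtorusW_one_tent_le (ψ : BondL2K ℂ d m c₁ W) :
    ‖QtorusW L m hL φ (fun _ : Bond d (fineP L m) => (1 : 𝔸ˣ)) hα1' hU1' hreg' (c₀ := c₀) (c₁ := c₁)
        ((WL2.equiv ℂ (fun _ : Bond d (fineP L m) => c₀) W).symm
          (fun b => (((((offset L m b.1 b.2 : ℕ) : ℝ) ^ 2 * ((L : ℝ) - 1 - (offset L m b.1 b.2 : ℕ))) *
              ∏ ν ∈ Finset.univ.erase b.2, (((offset L m b.1 ν : ℕ) : ℝ) * ((L : ℝ) - 1 - (offset L m b.1 ν : ℕ))) : ℝ) : ℂ) •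
            WL2.equiv ℂ (fun _ : Bond d m => c₁) W ψ (blockCoord L m b.1, b.2)))‖ ^ 2 ≤
      2 * ((((L : ℝ) ^ (d + 1))⁻¹ * ((∑ k ∈ Finset.range L, (k : ℝ) * ((L : ℝ) - 1 - k)) ^ (d - 1) *
          ∑ k ∈ Finset.range L, ∑ i ∈ Finset.range (L - k), ((k + i : ℕ) : ℝ) ^ 2 * ((L : ℝ) - 1 - ((k + i : ℕ) : ℝ)))) ^ 2 +
        (((L : ℝ) ^ (d + 1))⁻¹ * ((∑ k ∈ Finset.range L, (k : ℝ) * ((L : ℝ) - 1 - k)) ^ (d - 1) *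
          ∑ k ∈ Finset.range L, ∑ t ∈ Finset.range k, (t : ℝ) ^ 2 * ((L : ℝ) - 1 - t))) ^ 2) * ‖ψ‖ ^ 2 := by
  have hv := B9Eq3126BondTentLift.QtorusW_one_twoProfileLift_apply L m hL hα1' hU1' hreg' φ c₀ c₁
    (fun k : ℕ => (k : ℝ) * ((L : ℝ) - 1 - k)) (fun k : ℕ => (k : ℝ) ^ 2 * ((L : ℝ) - 1 - k)) ψ
  have h := B9Eq3126BondTentLift.norm_sq_le_of_twoBlock m c₁ _ ψ hv
  simpa only [Nat.cast_add] using h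

omit [∀ i, NeZero (fineP L m i)] [StarRing 𝔸] [StarModule ℂ 𝔸] [FiniteDimensional ℂ W] [Fact (0 < c₀)] [Fact (0 < c₁)] [NormedAlgebra ℂ 𝔸]
  [CompleteSpace 𝔸] [NormOneClass 𝔸] in
/-- **THE BOND TENT's PER-STEP BOUND**: every forward step changes the lift's coefficient-times-value by at most `6L²(L²∕4)^{d−1}·‖ψ(blk x, κ)‖`
(transverse profile: size `L²∕4`, step `L`; depth profile: size `L³`, step `2L²`; both vanish on the faces). [folklore]
[cite: Balaban1985Averaging, (2) p.17, (125) p.36; Balaban1984PropagatorsII, (2.74)–(2.77) p.236] -/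
theorem norm_tent_step_le (ψt : Bond d m → W) (x : TSite d (fineP L m)) (μ κ : Fin d) :
    ‖((((offset L m (shift μ x) κ : ℕ) : ℝ) ^ 2 * ((L : ℝ) - 1 - (offset L m (shift μ x) κ : ℕ)) *
          ∏ ν ∈ Finset.univ.erase κ, (((offset L m (shift μ x) ν : ℕ) : ℝ) * ((L : ℝ) - 1 - (offset L m (shift μ x) ν : ℕ))) : ℝ) : ℂ) •
          ψt (blockCoord L m (shift μ x), κ) -
        ((((offset L m x κ : ℕ) : ℝ) ^ 2 * ((L : ℝ) - 1 - (offset L m x κ : ℕ)) *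
          ∏ ν ∈ Finset.univ.erase κ, (((offset L m x ν : ℕ) : ℝ) * ((L : ℝ) - 1 - (offset L m x ν : ℕ))) : ℝ) : ℂ) •
          ψt (blockCoord L m x, κ)‖ ≤
      6 * (L : ℝ) ^ 2 * ((L : ℝ) ^ 2 / 4) ^ (d - 1) * ‖ψt (blockCoord L m x, κ)‖ := by
  have hL0 : (0 : ℝ) ≤ L := Nat.cast_nonneg L
  refine B9Eq3126BondLiftEnergy.norm_twoProfile_step_le L m (fun k : ℕ => (k : ℝ) * ((L : ℝ) - 1 - k))
    (fun k : ℕ => (k : ℝ) ^ 2 * ((L : ℝ) - 1 - k)) (s₀ := (L : ℝ) ^ 2 / 4) (s₁ := (L : ℝ) ^ 3) (δ₀ := L) (δ₁ := 2 * (L : ℝ) ^ 2)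
    (D := 6 * (L : ℝ) ^ 2 * ((L : ℝ) ^ 2 / 4) ^ (d - 1)) (by positivity)
    (fun k hk => B9Eq319BlockTentLift.profile_nonneg hk) (fun k _ => B9Eq319BlockTentLift.profile_le L k) (by simp)
    (fun k hk => B9Eq319BlockTentLift.profile_last hk) (fun k hk => ?_)
    (fun k hk => B9Eq3126BondTentProfile.qprof_nonneg hk) (fun k hk => B9Eq3126BondTentProfile.qprof_le hk) (by simp)
    (fun k hk => B9Eq3126BondTentProfile.qprof_last hk) (fun k hk => ?_) ?_ ?_ ψt x μ κ
  · have h := B9Eq319BlockTentLift.abs_profile_succ_sub_le hk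
    push_cast
    exact h
  · have h := B9Eq3126BondTentProfile.abs_qprof_succ_sub_le hk
    push_cast
    exact h
  · have h0 : 0 ≤ ((L : ℝ) ^ 2 / 4) ^ (d - 1) := by positivity
    nlinarith
  · intro hd
    have hd1 : d - 1 = (d - 2) + 1 := by omega
    rw [hd1, pow_succ ((L : ℝ) ^ 2 / 4) (d - 2)]
    have h0 : 0 ≤ ((L : ℝ) ^ 2 / 4) ^ (d - 2) := by positivity
    have h1 : (L : ℝ) ^ 3 * L * ((L : ℝ) ^ 2 / 4) ^ (d - 2) = 4 * ((L : ℝ) ^ 2 * (((L : ℝ) ^ 2 / 4) ^ (d - 2) * ((L : ℝ) ^ 2 / 4))) := by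
      ring
    rw [h1]
    nlinarith [mul_nonneg h0 (pow_nonneg hL0 4), mul_nonneg (pow_nonneg hL0 2) (mul_nonneg h0 (div_nonneg (pow_nonneg hL0 2) (by norm_num : (0:ℝ) ≤ 4)))]


/-- **THE ENERGY OF THE BOND TENT AT THE FLAT ONE-STEP OPERATOR**: for `a ≥ 0`,
`re⟪u_ψ, Δ_a(1)u_ψ⟫ ≤ (‖η⁻¹‖²·(6L²(L²∕4)^{d−1})²·5d·(c₀L^d∕c₁) + 2a(A² + B²))·‖ψ‖²` — §1 with the curl and divergence forms of
`B9Eq3126BondLiftEnergy` at the per-step bound `6L²(L²∕4)^{d−1}` and the size of `Q(1)u_ψ`.  On the diagonal `ηL = 1`, `c₀L^d = c₁` this is `L^{4d+2}` times a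
function of `(d, a)`, matching the squared margin. [folklore]
[cite: Balaban1985BackgroundPropagators, (3.26) p.395, (3.10)–(3.11) p.392, Thm 3.11 p.416; Balaban1985Averaging, (125) p.36] -/
theorem re_inner_laplaceAofBackground_one_tent_le {a : ℝ} (ha : 0 ≤ a) (ψ : BondL2K ℂ d m c₁ W) :
    RCLike.re ⟪((WL2.equiv ℂ (fun _ : Bond d (fineP L m) => c₀) W).symm
          (fun b => (((((offset L m b.1 b.2 : ℕ) : ℝ) ^ 2 * ((L : ℝ) - 1 - (offset L m b.1 b.2 : ℕ))) *
              ∏ ν ∈ Finset.univ.erase b.2, (((offset L m b.1 ν : ℕ) : ℝ) * ((L : ℝ) - 1 - (offset L m b.1 ν : ℕ))) : ℝ) : ℂ) •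
            WL2.equiv ℂ (fun _ : Bond d m => c₁) W ψ (blockCoord L m b.1, b.2))),
        laplaceAofBackground L m hL φ (fun _ : Bond d (fineP L m) => (1 : 𝔸ˣ)) hα1' hU1' hreg' τ η (c₀ := c₀) (c₁ := c₁) a
          ((WL2.equiv ℂ (fun _ : Bond d (fineP L m) => c₀) W).symm
          (fun b => (((((offset L m b.1 b.2 : ℕ) : ℝ) ^ 2 * ((L : ℝ) - 1 - (offset L m b.1 b.2 : ℕ))) *
              ∏ ν ∈ Finset.univ.erase b.2, (((offset L m b.1 ν : ℕ) : ℝ) * ((L : ℝ) - 1 - (offset L m b.1 ν : ℕ))) : ℝ) : ℂ) •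
            WL2.equiv ℂ (fun _ : Bond d m => c₁) W ψ (blockCoord L m b.1, b.2)))⟫_ℂ ≤
      (‖((η : ℂ))⁻¹‖ ^ 2 * (6 * (L : ℝ) ^ 2 * ((L : ℝ) ^ 2 / 4) ^ (d - 1)) ^ 2 * (5 * (d : ℝ)) * (c₀ * (L : ℝ) ^ d / c₁) +
        a * (2 * ((((L : ℝ) ^ (d + 1))⁻¹ * ((∑ k ∈ Finset.range L, (k : ℝ) * ((L : ℝ) - 1 - k)) ^ (d - 1) *
          ∑ k ∈ Finset.range L, ∑ i ∈ Finset.range (L - k), ((k + i : ℕ) : ℝ) ^ 2 * ((L : ℝ) - 1 - ((k + i : ℕ) : ℝ)))) ^ 2 +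
        (((L : ℝ) ^ (d + 1))⁻¹ * ((∑ k ∈ Finset.range L, (k : ℝ) * ((L : ℝ) - 1 - k)) ^ (d - 1) *
          ∑ k ∈ Finset.range L, ∑ t ∈ Finset.range k, (t : ℝ) ^ 2 * ((L : ℝ) - 1 - t))) ^ 2))) * ‖ψ‖ ^ 2 := by
  set ψt := WL2.equiv ℂ (fun _ : Bond d m => c₁) W ψ with hψt
  set ut : Bond d (fineP L m) → W := fun b => (((((offset L m b.1 b.2 : ℕ) : ℝ) ^ 2 * ((L : ℝ) - 1 - (offset L m b.1 b.2 : ℕ))) *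
      ∏ ν ∈ Finset.univ.erase b.2, (((offset L m b.1 ν : ℕ) : ℝ) * ((L : ℝ) - 1 - (offset L m b.1 ν : ℕ))) : ℝ) : ℂ) • ψt (blockCoord L m b.1, b.2)
    with hut
  have hstep : ∀ (x : TSite d (fineP L m)) (μ κ : Fin d),
      ‖ut (shift μ x, κ) - ut (x, κ)‖ ≤ 6 * (L : ℝ) ^ 2 * ((L : ℝ) ^ 2 / 4) ^ (d - 1) * ‖ψt (blockCoord L m x, κ)‖ :=
    fun x μ κ => norm_tent_step_le L m ψt x μ κ
  have hE := re_inner_laplaceAofBackground_one_le L m hL hα1' hU1' hreg' φ τ η (c₀ := c₀) (c₁ := c₁) a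
    ((WL2.equiv ℂ (fun _ : Bond d (fineP L m) => c₀) W).symm ut)
  have hcurl := B9Eq3126BondLiftEnergy.norm_sq_covCurlL2K_le_of_step L m c₀ c₁ ((η : ℂ))⁻¹
    (adTransportW φ (fun _ : Bond d (fineP L m) => (1 : 𝔸ˣ))) (adTransportW_one φ) ut ψ hstep
  have hdiv := B9Eq3126BondLiftEnergy.norm_sq_covDivL2K_le_of_step L m c₀ c₁ ((η : ℂ))⁻¹
    (adTransportW φ (fun _ : Bond d (fineP L m) => (1 : 𝔸ˣ)⁻¹)) (B5Eq172HodgePositivity.adTransportW_inv_one φ) ut ψ hstep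
  have hQn := norm_sq_QtorusW_one_tent_le L m hL hα1' hU1' hreg' φ (c₀ := c₀) (c₁ := c₁) ψ
  have hQa := mul_le_mul_of_nonneg_left hQn ha
  have hX : 0 ≤ ‖((η : ℂ))⁻¹‖ ^ 2 * (6 * (L : ℝ) ^ 2 * ((L : ℝ) ^ 2 / 4) ^ (d - 1)) ^ 2 * (c₀ * (L : ℝ) ^ d / c₁) * ‖ψ‖ ^ 2 := by
    have hc₀ : 0 < c₀ := Fact.out
    have hc₁ : 0 < c₁ := Fact.out
    positivity
  refine hE.trans ?_
  nlinarith [hcurl, hdiv, hQa, hX]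

end TestFamily

/-! ## §3 The floor of `Q(1)G₁(1)Q(1)†` and the size of `H₁(1)` from the bond tent — no operator bound of `Δ_a` -/

section Floor

variable {d : ℕ} (L : ℕ) [NeZero L] (m : Fin d → ℕ) [∀ i, NeZero (fineP L m i)]
  {𝔸 : Type*} [NormedRing 𝔸] [NormedAlgebra ℂ 𝔸] [CompleteSpace 𝔸] [NormOneClass 𝔸] [StarRing 𝔸] [StarModule ℂ 𝔸] (hL : 1 ≤ L)
  {α' : ℝ} (hα1' : α' ≤ 1 / 64)
  (hU1' : ∀ (x : B7Prop1Explicit.Site d) (κ : Fin d), perCfg (fineP L m) (fun _ : Bond d (fineP L m) => (1 : 𝔸ˣ)) x κ ∈ U1 𝔸)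
  (hreg' : ∀ (y : TSite d m) (κ : Fin d) (r : Fin d → Fin L),
    ‖((Wcx L (perCfg (fineP L m) (fun _ : Bond d (fineP L m) => (1 : 𝔸ˣ))) (cornerSite L y) κ (boxVec L r) : 𝔸ˣ) : 𝔸) - 1‖ ≤ α')
  {W : Type*} [NormedAddCommGroup W] [InnerProductSpace ℂ W] [FiniteDimensional ℂ W] (φ : W ≃ₗ[ℂ] 𝔸)
  {c₀ c₁ : ℝ} [Fact (0 < c₀)] [Fact (0 < c₁)] (τ : 𝔸 →ₗ[ℂ] ℂ) (η : ℝ)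

/-- `Δ_a(1)` of the chain is symmetric (flat transporters are mutually adjoint, `Δ(1) = D*D`, `R(1)` an orthogonal projection). [folklore]
[cite: Balaban1985BackgroundPropagators, (3.26) p.395, (3.10) p.392, (3.21) p.394; Balaban1985Variational, p.293] -/
theorem laplaceAofBackground_one_isSymmetric (a : ℝ) :
    (laplaceAofBackground L m hL φ (fun _ : Bond d (fineP L m) => (1 : 𝔸ˣ)) hα1' hU1' hreg' τ η (c₀ := c₀) (c₁ := c₁) a).IsSymmetric := by
  have hc : conj (((η : ℂ))⁻¹) = ((η : ℂ))⁻¹ := by rw [map_inv₀, Complex.conj_ofReal]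
  have hΔ : (hessOp φ η (fun _ : Bond d (fineP L m) => (1 : 𝔸ˣ)) τ (c₀ := c₀)).IsSymmetric := by
    rw [hessOp_one]; exact principalOpK_isSymmetric φ η _ (hRS_one φ)
  rw [laplaceAofBackground_eq, laplaceAofU_eq]
  exact B11Eq103H1Complex.laplaceALatticeK_isSymmetric hc (hRS_one φ) hΔ (RofU_isSymmetric L m φ η _)

/-- **THE VARIATIONAL FLOOR OF `K = Q(1)G₁(1)Q(1)†` AND THE SIZE OF `H₁(1) = G₁Q†K⁻¹` FROM THE BOND TENT** — for `3 ≤ L`, `a > 0`, a coercivity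
constant `γ` of `Δ_a(1)` (displayed) and ANY witnesses `hpos`, `hQ`:
`‖(QG₁Q†)⁻¹y‖ ≤ (M_u∕(A−B)²)·‖y‖` and `‖H₁b‖ ≤ √(M_u∕(γ(A−B)²))·‖b‖`, with the tent's pairing margin `A − B` (`≥ L^{−(d+1)}(L³∕27)^{d−1}L⁵∕1215`,
`tent_margin_ge`) and energy `M_u = ‖η⁻¹‖²(6L²(L²∕4)^{d−1})²·5d·(c₀L^d∕c₁) + 2a(A²+B²)` — `B9Eq3126GreenLettersVariational.norm_KinvK_le_of_test` ∕
`norm_H1K_le_of_test` at the chain's one-step letters: NO operator bound of `Δ_a(1)` (the `M ∝ |η|⁻²` of `B9Eq3126GreenLetters`), no volume. [folklore]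
[cite: Balaban1985BackgroundPropagators, (3.126) p.420, Thm 3.11 p.416, (3.26) p.395; Balaban1985Variational, (45)–(46) p.285] -/
theorem norm_KinvLatticeK_H1LatticeK_one_le (hL3 : 3 ≤ L) {a : ℝ} (ha : 0 < a) {γ : ℝ} (hγ : 0 < γ)
    (hcoer : ∀ x : BondL2K ℂ d (fineP L m) c₀ W, γ * ‖x‖ ^ 2 ≤
      RCLike.re ⟪x, laplaceAofBackground L m hL φ (fun _ : Bond d (fineP L m) => (1 : 𝔸ˣ)) hα1' hU1' hreg' τ η (c₀ := c₀) (c₁ := c₁) a x⟫_ℂ)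
    (hpos : ∀ x : BondL2K ℂ d (fineP L m) c₀ W, x ≠ 0 →
      0 < RCLike.re ⟪x, laplaceAofBackground L m hL φ (fun _ : Bond d (fineP L m) => (1 : 𝔸ˣ)) hα1' hU1' hreg' τ η (c₀ := c₀) (c₁ := c₁) a x⟫_ℂ)
    (hQ : Function.Surjective (QtorusW L m hL φ (fun _ : Bond d (fineP L m) => (1 : 𝔸ˣ)) hα1' hU1' hreg' (c₀ := c₀) (c₁ := c₁))) :
    (∀ y : BondL2K ℂ d m c₁ W, ‖KinvLatticeK hpos hQ y‖ ≤
        (‖((η : ℂ))⁻¹‖ ^ 2 * (6 * (L : ℝ) ^ 2 * ((L : ℝ) ^ 2 / 4) ^ (d - 1)) ^ 2 * (5 * (d : ℝ)) * (c₀ * (L : ℝ) ^ d / c₁) +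
        a * (2 * ((((L : ℝ) ^ (d + 1))⁻¹ * ((∑ k ∈ Finset.range L, (k : ℝ) * ((L : ℝ) - 1 - k)) ^ (d - 1) *
          ∑ k ∈ Finset.range L, ∑ i ∈ Finset.range (L - k), ((k + i : ℕ) : ℝ) ^ 2 * ((L : ℝ) - 1 - ((k + i : ℕ) : ℝ)))) ^ 2 +
        (((L : ℝ) ^ (d + 1))⁻¹ * ((∑ k ∈ Finset.range L, (k : ℝ) * ((L : ℝ) - 1 - k)) ^ (d - 1) *
          ∑ k ∈ Finset.range L, ∑ t ∈ Finset.range k, (t : ℝ) ^ 2 * ((L : ℝ) - 1 - t))) ^ 2))) /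
          ((((L : ℝ) ^ (d + 1))⁻¹ * ((∑ k ∈ Finset.range L, (k : ℝ) * ((L : ℝ) - 1 - k)) ^ (d - 1) *
          ∑ k ∈ Finset.range L, ∑ i ∈ Finset.range (L - k), ((k + i : ℕ) : ℝ) ^ 2 * ((L : ℝ) - 1 - ((k + i : ℕ) : ℝ)))) -
           (((L : ℝ) ^ (d + 1))⁻¹ * ((∑ k ∈ Finset.range L, (k : ℝ) * ((L : ℝ) - 1 - k)) ^ (d - 1) *
          ∑ k ∈ Finset.range L, ∑ t ∈ Finset.range k, (t : ℝ) ^ 2 * ((L : ℝ) - 1 - t)))) ^ 2 * ‖y‖) ∧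
      ∀ b : BondL2K ℂ d m c₁ W, ‖H1LatticeK hpos hQ b‖ ≤
        Real.sqrt ((‖((η : ℂ))⁻¹‖ ^ 2 * (6 * (L : ℝ) ^ 2 * ((L : ℝ) ^ 2 / 4) ^ (d - 1)) ^ 2 * (5 * (d : ℝ)) * (c₀ * (L : ℝ) ^ d / c₁) +
        a * (2 * ((((L : ℝ) ^ (d + 1))⁻¹ * ((∑ k ∈ Finset.range L, (k : ℝ) * ((L : ℝ) - 1 - k)) ^ (d - 1) *
          ∑ k ∈ Finset.range L, ∑ i ∈ Finset.range (L - k), ((k + i : ℕ) : ℝ) ^ 2 * ((L : ℝ) - 1 - ((k + i : ℕ) : ℝ)))) ^ 2 +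
        (((L : ℝ) ^ (d + 1))⁻¹ * ((∑ k ∈ Finset.range L, (k : ℝ) * ((L : ℝ) - 1 - k)) ^ (d - 1) *
          ∑ k ∈ Finset.range L, ∑ t ∈ Finset.range k, (t : ℝ) ^ 2 * ((L : ℝ) - 1 - t))) ^ 2))) /
          (γ * ((((L : ℝ) ^ (d + 1))⁻¹ * ((∑ k ∈ Finset.range L, (k : ℝ) * ((L : ℝ) - 1 - k)) ^ (d - 1) *
          ∑ k ∈ Finset.range L, ∑ i ∈ Finset.range (L - k), ((k + i : ℕ) : ℝ) ^ 2 * ((L : ℝ) - 1 - ((k + i : ℕ) : ℝ)))) -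
           (((L : ℝ) ^ (d + 1))⁻¹ * ((∑ k ∈ Finset.range L, (k : ℝ) * ((L : ℝ) - 1 - k)) ^ (d - 1) *
          ∑ k ∈ Finset.range L, ∑ t ∈ Finset.range k, (t : ℝ) ^ 2 * ((L : ℝ) - 1 - t)))) ^ 2)) * ‖b‖ := by
  have hc₀ : 0 < c₀ := Fact.out
  have hc₁ : 0 < c₁ := Fact.out
  have hL0 : (0 : ℝ) < L := by exact_mod_cast (by omega : 0 < L)
  have hTs := laplaceAofBackground_one_isSymmetric L m hL hα1' hU1' hreg' φ τ η (c₀ := c₀) (c₁ := c₁) a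
  -- the margin is positive
  have hβ : 0 < (((L : ℝ) ^ (d + 1))⁻¹ * ((∑ k ∈ Finset.range L, (k : ℝ) * ((L : ℝ) - 1 - k)) ^ (d - 1) *
          ∑ k ∈ Finset.range L, ∑ i ∈ Finset.range (L - k), ((k + i : ℕ) : ℝ) ^ 2 * ((L : ℝ) - 1 - ((k + i : ℕ) : ℝ)))) -
           (((L : ℝ) ^ (d + 1))⁻¹ * ((∑ k ∈ Finset.range L, (k : ℝ) * ((L : ℝ) - 1 - k)) ^ (d - 1) *
          ∑ k ∈ Finset.range L, ∑ t ∈ Finset.range k, (t : ℝ) ^ 2 * ((L : ℝ) - 1 - t))) := by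
    refine lt_of_lt_of_le ?_ (tent_margin_ge L hL3)
    positivity
  -- the test family
  have hux := fun ψ : BondL2K ℂ d m c₁ W => re_inner_QtorusW_one_tent_ge L m hL hα1' hU1' hreg' φ (c₀ := c₀) (c₁ := c₁) ψ
  have huu := fun ψ : BondL2K ℂ d m c₁ W => re_inner_laplaceAofBackground_one_tent_le L m hL hα1' hU1' hreg' φ τ η (c₀ := c₀) (c₁ := c₁) ha.le ψ
  -- `M_u > 0`: the `a`-term is positive since `A > B ≥ 0`
  have hA : 0 < (((L : ℝ) ^ (d + 1))⁻¹ * ((∑ k ∈ Finset.range L, (k : ℝ) * ((L : ℝ) - 1 - k)) ^ (d - 1) *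
          ∑ k ∈ Finset.range L, ∑ i ∈ Finset.range (L - k), ((k + i : ℕ) : ℝ) ^ 2 * ((L : ℝ) - 1 - ((k + i : ℕ) : ℝ)))) := by
    refine lt_of_lt_of_le hβ (sub_le_self _ ?_)
    have h0 : 0 ≤ ∑ k ∈ Finset.range L, (k : ℝ) * ((L : ℝ) - 1 - k) :=
      Finset.sum_nonneg fun k hk => B9Eq319BlockTentLift.profile_nonneg (Finset.mem_range.1 hk)
    have h1 : 0 ≤ ∑ k ∈ Finset.range L, ∑ t ∈ Finset.range k, (t : ℝ) ^ 2 * ((L : ℝ) - 1 - t) :=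
      Finset.sum_nonneg fun k hk => Finset.sum_nonneg fun t ht =>
        B9Eq3126BondTentProfile.qprof_nonneg (lt_trans (Finset.mem_range.1 ht) (Finset.mem_range.1 hk))
    positivity
  have hMu : 0 < (‖((η : ℂ))⁻¹‖ ^ 2 * (6 * (L : ℝ) ^ 2 * ((L : ℝ) ^ 2 / 4) ^ (d - 1)) ^ 2 * (5 * (d : ℝ)) * (c₀ * (L : ℝ) ^ d / c₁) +
        a * (2 * ((((L : ℝ) ^ (d + 1))⁻¹ * ((∑ k ∈ Finset.range L, (k : ℝ) * ((L : ℝ) - 1 - k)) ^ (d - 1) *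
          ∑ k ∈ Finset.range L, ∑ i ∈ Finset.range (L - k), ((k + i : ℕ) : ℝ) ^ 2 * ((L : ℝ) - 1 - ((k + i : ℕ) : ℝ)))) ^ 2 +
        (((L : ℝ) ^ (d + 1))⁻¹ * ((∑ k ∈ Finset.range L, (k : ℝ) * ((L : ℝ) - 1 - k)) ^ (d - 1) *
          ∑ k ∈ Finset.range L, ∑ t ∈ Finset.range k, (t : ℝ) ^ 2 * ((L : ℝ) - 1 - t))) ^ 2))) := by
    have h1 : 0 < a * (2 * ((((L : ℝ) ^ (d + 1))⁻¹ * ((∑ k ∈ Finset.range L, (k : ℝ) * ((L : ℝ) - 1 - k)) ^ (d - 1) *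
          ∑ k ∈ Finset.range L, ∑ i ∈ Finset.range (L - k), ((k + i : ℕ) : ℝ) ^ 2 * ((L : ℝ) - 1 - ((k + i : ℕ) : ℝ)))) ^ 2 +
        (((L : ℝ) ^ (d + 1))⁻¹ * ((∑ k ∈ Finset.range L, (k : ℝ) * ((L : ℝ) - 1 - k)) ^ (d - 1) *
          ∑ k ∈ Finset.range L, ∑ t ∈ Finset.range k, (t : ℝ) ^ 2 * ((L : ℝ) - 1 - t))) ^ 2)) := by positivity
    have h2 : 0 ≤ ‖((η : ℂ))⁻¹‖ ^ 2 * (6 * (L : ℝ) ^ 2 * ((L : ℝ) ^ 2 / 4) ^ (d - 1)) ^ 2 * (5 * (d : ℝ)) * (c₀ * (L : ℝ) ^ d / c₁) := by positivity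
    linarith
  refine ⟨fun y => ?_, fun b => ?_⟩
  · have h := B9Eq3126GreenLettersVariational.norm_KinvK_le_of_test (𝕜 := ℂ) hpos hadj_adjoint
      (adjoint_injective_of_surjective _ hQ) hTs hMu hβ hux huu y
    exact h
  · have h := B9Eq3126GreenLettersVariational.norm_H1K_le_of_test (𝕜 := ℂ) hpos hadj_adjoint
      (adjoint_injective_of_surjective _ hQ) hγ hcoer hTs hMu hβ hux huu b
    exact h

end Floor

end Literature.MathematicalPhysics.QuantumFieldTheory.Balaban1983to89.B9Eq3126KFloorFlat

end
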